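import Summits.Ventures.DiscreteObjects.Hadamard.ElemAbelianRank2_7

/-!
# Hadamard 668 census, family F12 — dictionary lemmas: from subgroups of the signed automorphism group to the
# hypotheses of the census theorems (kernel)

Framing: lottery ticket; floor = certified bounds/negative ranges.

Cell pub-namedobj (venture DiscreteObjects), target (H), hadamard gen 17 (lead g13 item H13-1).  The census theorems
(`no_hadamard668_elemAbelian_rank2_ge7`, `hadamard668_signedAut_not_dvd_orderOf_343`, …) speak about signed-permutation
automorphisms `(π, κ, d, e)` (`H (π i) (κ j) = d i · e j · H i j`) with hypotheses on the PERMUTATION parts (exponent,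
commutation, independence of the row parts).  The words 'no subgroup `C_p × C_p` of Aut± H(668)' rest on the
following dictionary, recorded here in the kernel so that the group-theoretic sentence is a literal corollary:
* **`signedAut_pm_one_of_fst_eq_one`**: a signed automorphism of a Hadamard matrix whose ROW permutation is trivial
  and whose column permutation has odd exponent is `±(1, 1)`: `κ = 1` (`signedAut_snd_eq_one`, gen 6) and
  `d = e =` one constant sign.  Dually `signedAut_pm_one_of_snd_eq_one`.  [So in a subgroup of Aut± of odd order the
  map 'signed pair ↦ row permutation' is injective: its kernel consists of `±I`, and `−I` has order `2`.]
* **`pairPerm_snd_ne_one`**: for two signed automorphisms with `p`-th powers trivial (`p` odd prime) and commuting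
  parts, independence of the ROW parts (`α^a β^b = 1 ⇒ a = b = 0`) implies that every `g ≠ 1` of `(ℤ/p)²` acts
  nontrivially on the COLUMNS too (`α'^a β'^b ≠ 1`); `pairPerm_col_independent`: hence the column parts are
  independent as well — the census hypotheses are symmetric under transposition.
Ours, not literature; no `sorry`.
-/

namespace Summit.Ventures.DiscreteObjects.Hadamard

open Finset BigOperators Matrix

open Literature.Combinatorics.Designs.GoethalsSeidel (IsHadamardMatrix)

variable {ι : Type*} [Fintype ι] [DecidableEq ι]

section dictionary
variable {H : Matrix ι ι ℤ}

/-- **trivial row part, odd exponent ⇒ the signed automorphism is `±(1,1)`**: `κ = 1` and both sign vectors equal one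
constant sign `c = ±1`. -/
theorem signedAut_pm_one_of_fst_eq_one (hH : IsHadamardMatrix H) (hcard : (Fintype.card ι : ℤ) ≠ 0)
    {κ : Equiv.Perm ι} {d e : ι → ℤ} (haut : IsSignedAut H 1 κ d e) {p : ℕ} (hp : Odd p) (hκ : κ ^ p = 1) :
    κ = 1 ∧ ∃ c : ℤ, (c = 1 ∨ c = -1) ∧ (∀ i, d i = c) ∧ (∀ j, e j = c) := by
  have hκ1 : κ = 1 := signedAut_snd_eq_one H hH hcard haut hp hκ
  refine ⟨hκ1, ?_⟩
  obtain ⟨hd, he, hrel⟩ := haut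
  rw [hκ1] at hrel
  -- d i * e j = 1 for all i, j
  have hde : ∀ i j, d i * e j = 1 := by
    intro i j
    have h := hrel i j
    simp only [Equiv.Perm.one_apply] at h
    have hne : H i j ≠ 0 := pm_ne_zero (hH.1 i j)
    have h2 : (d i * e j - 1) * H i j = 0 := by linarith
    rcases mul_eq_zero.mp h2 with h0 | h0
    · linarith
    · exact absurd h0 hne
  rcases isEmpty_or_nonempty ι with hι | ⟨⟨i₀⟩⟩
  · exact ⟨1, Or.inl rfl, fun i => (IsEmpty.false i).elim, fun j => (IsEmpty.false j).elim⟩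
  refine ⟨d i₀, hd i₀, fun i => ?_, fun j => ?_⟩
  · have h1 := hde i i₀
    have h2 := hde i₀ i₀
    have hee : e i₀ * e i₀ = 1 := pm_mul_self (he i₀)
    calc d i = d i * (e i₀ * e i₀) := by rw [hee, mul_one]
      _ = (d i * e i₀) * e i₀ := by ring
      _ = (d i₀ * e i₀) * e i₀ := by rw [h1, h2]
      _ = d i₀ * (e i₀ * e i₀) := by ring
      _ = d i₀ := by rw [hee, mul_one]
  · have h1 := hde i₀ j
    have hdd : d i₀ * d i₀ = 1 := pm_mul_self (hd i₀)
    calc e j = (d i₀ * d i₀) * e j := by rw [hdd, one_mul]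
      _ = d i₀ * (d i₀ * e j) := by ring
      _ = d i₀ := by rw [h1, mul_one]

/-- dual form: **trivial column part, odd exponent ⇒ `±(1,1)`** -/
theorem signedAut_pm_one_of_snd_eq_one (hH : IsHadamardMatrix H) (hcard : (Fintype.card ι : ℤ) ≠ 0)
    {π : Equiv.Perm ι} {d e : ι → ℤ} (haut : IsSignedAut H π 1 d e) {p : ℕ} (hp : Odd p) (hπ : π ^ p = 1) :
    π = 1 ∧ ∃ c : ℤ, (c = 1 ∨ c = -1) ∧ (∀ i, d i = c) ∧ (∀ j, e j = c) := by
  obtain ⟨h1, c, hc, he, hd⟩ := signedAut_pm_one_of_fst_eq_one (isHadamard_transpose hH hcard) hcard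
    (isSignedAut_transpose haut) hp hπ
  exact ⟨h1, c, hc, hd, he⟩

variable (p : ℕ) [hp : Fact p.Prime]

/-- **independent row parts ⇒ nontrivial column parts**: for two signed automorphisms with `p`-th powers trivial
(`p` an odd prime), commuting parts and independent row parts, every `g ≠ 1` of `(ℤ/p)²` moves some column. -/
theorem pairPerm_snd_ne_one (hH : IsHadamardMatrix H) (hcard : (Fintype.card ι : ℤ) ≠ 0) (hodd : Odd p)
    {α α' β β' : Equiv.Perm ι} {d₁ e₁ d₂ e₂ : ι → ℤ}
    (hA : IsSignedAut H α α' d₁ e₁) (hB : IsSignedAut H β β' d₂ e₂)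
    (hα : α ^ p = 1) (hβ : β ^ p = 1) (hc : Commute α β)
    (hind : ∀ a b : ℕ, a < p → b < p → α ^ a * β ^ b = 1 → a = 0 ∧ b = 0)
    {g : Multiplicative (ZMod p × ZMod p)} (hg : g ≠ 1) :
    α' ^ (Multiplicative.toAdd g).1.val * β' ^ (Multiplicative.toAdd g).2.val ≠ 1 := by
  intro h1
  obtain ⟨d, e, hg'⟩ := isSignedAut_pair p hA hB g
  rw [h1] at hg'
  have h := (signedAut_pm_one_of_snd_eq_one hH hcard hg' hodd (pairPerm_pow_p p α β hα hβ hc g)).1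
  exact pairPerm_ne_one p α β hind hg h

/-- **independent row parts ⇒ independent column parts.** -/
theorem pairPerm_col_independent (hH : IsHadamardMatrix H) (hcard : (Fintype.card ι : ℤ) ≠ 0) (hodd : Odd p)
    {α α' β β' : Equiv.Perm ι} {d₁ e₁ d₂ e₂ : ι → ℤ}
    (hA : IsSignedAut H α α' d₁ e₁) (hB : IsSignedAut H β β' d₂ e₂)
    (hα : α ^ p = 1) (hβ : β ^ p = 1) (hc : Commute α β)
    (hind : ∀ a b : ℕ, a < p → b < p → α ^ a * β ^ b = 1 → a = 0 ∧ b = 0) :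
    ∀ a b : ℕ, a < p → b < p → α' ^ a * β' ^ b = 1 → a = 0 ∧ b = 0 := by
  haveI : NeZero p := ⟨hp.out.ne_zero⟩
  intro a b ha hb hab
  set g : Multiplicative (ZMod p × ZMod p) := Multiplicative.ofAdd (((a : ℕ) : ZMod p), ((b : ℕ) : ZMod p)) with hgdef
  have hga : (Multiplicative.toAdd g).1.val = a := by
    rw [hgdef, toAdd_ofAdd]; exact ZMod.val_cast_of_lt ha
  have hgb : (Multiplicative.toAdd g).2.val = b := by
    rw [hgdef, toAdd_ofAdd]; exact ZMod.val_cast_of_lt hb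
  by_cases hg : g = 1
  · have h0 := congrArg Multiplicative.toAdd hg
    rw [hgdef, toAdd_ofAdd, toAdd_one, Prod.mk_eq_zero] at h0
    obtain ⟨h0a, h0b⟩ := h0
    rw [ZMod.natCast_eq_zero_iff] at h0a h0b
    exact ⟨Nat.eq_zero_of_dvd_of_lt h0a ha, Nat.eq_zero_of_dvd_of_lt h0b hb⟩
  · exfalso
    apply pairPerm_snd_ne_one p hH hcard hodd hA hB hα hβ hc hind hg
    rw [hga, hgb]; exact hab

end dictionary

end Summit.Ventures.DiscreteObjects.Hadamard
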